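import Literature.AlgebraicGeometry.Resolution.ArithmeticalThreefoldsLocalIndependent
import Literature.AlgebraicGeometry.Resolution.ValuedFunctionFieldsLemmas
import HarnessLib

/-!
# Cossart–Piltant 2019: the tower form of Thm. 1.5 implies the weak local-uniformization form

Topic: `Literature/AlgebraicGeometry/Resolution`; kernel companion (no new facts) of
`ArithmeticalThreefoldsLocalIndependent.lean`: the PROVED edge
`CossartPiltant2019Local_of_thm_1_5 : CossartPiltant2019_thm_1_5 → CossartPiltant2019Local` — a tower of local
blowing ups with respect to `O` ending with a regular local ring is ONE local blowing up
`(S[x][t])_{𝔪_O ∩ S[x][t]}` with `t ⊆ O` finite (`LocalBlowup.exists_fg_regular_of_tower`, Novacoski–Spivakovsky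
Lemma 2.9), which is the conclusion of the weak form.  `x ∈ O` because `x` is integral over `S ⊆ O`
(`mem_of_isIntegral_of_le`).  Also the bookkeeping edge
`CossartPiltant2019_exitMultiplicityP_independent_of'` (F-99b′ ⇒ F-99b, dropping the regular-exit clause).
AI-written; weaker than expert review.

## Sources

* V. Cossart, O. Piltant, J. Algebra 529 (2019) 268–535, Thm. 1.5. [CossartPiltant2019]
* J. Novacoski, M. Spivakovsky, arXiv:1204.4751, Lemma 2.9. [NovacoskiSpivakovsky2014]
-/

noncomputable section

open IsLocalRing Polynomial

namespace Literature.AlgebraicGeometry.Resolution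

universe u

/-! ## The tower form implies the weak local-uniformization form -/

/-- A run of local blowing ups along `O` starting at `locAtCentre B O` composes into ONE local blowing
up of `B` (Novacoski–Spivakovsky Lemma 2.9, via `IsLocalBlowup.trans`). [folklore] -/
private theorem isLocalBlowup_of_run {L : Type u} [Field L] {O : ValuationSubring L} {B : Subring L}
    (hB : B ≤ O.toSubring) {R : ℕ → Subring L} {P : ∀ i, Ideal (R i)} {n : ℕ}
    (h0 : R 0 = locAtCentre B O) (hstep : ∀ i < n, IsLocalBlowupAlong O (R i) (P i) (R (i + 1))) :
    IsLocalBlowup O B (R n) := by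
  induction n with
  | zero => rw [h0]; exact IsLocalBlowup.locAtCentre_self hB
  | succ k ih =>
    exact (ih fun i hi => hstep i (Nat.lt_succ_of_lt hi)).trans
      (hstep k (Nat.lt_succ_self k)).isLocalBlowup

/-- `S[x ∪ t] = (S[x])[t]` as subrings of `L`. [folklore] -/
private theorem adjoin_insert_toSubring_eq_closure {S L : Type u} [CommRing S] [Field L] [Algebra S L]
    (x : L) (t : Finset L) :
    (Algebra.adjoin S (insert x (t : Set L))).toSubring =
      Subring.closure (((Algebra.adjoin S ({x} : Set L)).toSubring : Set L) ∪ ↑t) := by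
  rw [Algebra.adjoin_eq_ring_closure, Algebra.adjoin_eq_ring_closure, Set.insert_eq, ← Set.union_assoc,
    Subring.closure_union (Set.range (algebraMap S L) ∪ {x}) (t : Set L),
    Subring.closure_union (Subring.closure (Set.range (algebraMap S L) ∪ {x}) : Set L) (t : Set L),
    Subring.closure_eq]

/-- **The tower form of Thm. 1.5 implies the weak local-uniformization form** `CossartPiltant2019Local`
(`ArithmeticalThreefoldsLocal.lean`): a tower of local blowing ups ending with a regular local ring is
ONE local blowing up `(S[x][t])_{𝔪_O ∩ S[x][t]}` with `t ⊆ O` finite (`exists_fg_regular_of_tower`).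
[cite: CossartPiltant2019, Thm. 1.5 (J. Algebra 529, pp. 271–272)] -/
theorem CossartPiltant2019Local_of_thm_1_5 (H : CossartPiltant2019_thm_1_5.{u}) :
    CossartPiltant2019Local.{u} := by
  intro p hp S _ _ _ hexc hdim hchar K _ _ _ L _ _ _ _ h x hmon hdeg hirr hx hadj hG O hSO hcen
  obtain ⟨n, R, P, h0, hstep, hreg⟩ :=
    H p hp S hexc hdim hchar K L h x hmon hdeg hirr hx hadj hG O hSO hcen
  -- `B = S[x] ⊆ O`: `x` is integral over `S ⊆ O`
  set B : Subring L := (Algebra.adjoin S ({x} : Set L)).toSubring with hBdef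
  have hrange : (algebraMap S L).range ≤ O.toSubring := by
    rintro _ ⟨s, rfl⟩
    exact hSO s
  have hxO : x ∈ O := by
    refine mem_of_isIntegral_of_le hrange (x := x) ?_
    refine ⟨h.map (algebraMap S L).rangeRestrict, hmon.map _, ?_⟩
    have : (algebraMap (algebraMap S L).range L).comp (algebraMap S L).rangeRestrict = algebraMap S L := by
      ext s; rfl
    rw [eval₂_map, this]
    exact hx
  have hB : B ≤ O.toSubring := by
    rw [hBdef, Algebra.adjoin_eq_ring_closure]
    refine Subring.closure_le.mpr (Set.union_subset ?_ (Set.singleton_subset_iff.mpr hxO))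
    rintro _ ⟨s, rfl⟩
    exact hSO s
  -- the tower is one local blowing up of `B`, ending with the regular local ring `R n`
  have hlb : IsLocalBlowup O B (R n) := isLocalBlowup_of_run hB h0 fun i hi => (hstep i hi).2
  obtain ⟨t, ht, hreg'⟩ :=
    exists_fg_regular_of_tower hB (Relation.ReflTransGen.single hlb) hlb.locAtCentre_eq hreg
  have e := adjoin_insert_toSubring_eq_closure (S := S) x t
  have ht' : (Algebra.adjoin S (insert x (t : Set L))).toSubring ≤ O.toSubring := e ▸ ht
  exact ⟨t, ht', (isRegularLocalRing_centre_congr e ht' ht).mpr hreg'⟩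


/-- **F-99b′ implies F-99b**: drop the regularity clause of the exit. [cite: CossartPiltant2019, Thm. 2.81 and Thm. 5.5 (J. Algebra 529, pp. 341, 405)] -/
theorem CossartPiltant2019_exitMultiplicityP_independent_of'
    (H : CossartPiltant2019_exitMultiplicityP_independent'.{u}) :
    CossartPiltant2019_exitMultiplicityP_independent.{u} := by
  intro p hp S _ _ _ hexc hdim hchar K _ _ _ L _ _ _ _ h x hmon hdeg hirr hx hadj hG e u hE
  obtain ⟨centre, hcentre⟩ := H p hp S hexc hdim hchar K L h x hmon hdeg hirr hx hadj hG e u hE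
  refine ⟨centre, fun O hSO hcen => ?_⟩
  obtain ⟨n, R, P, h0, hstep, hloc, hlt, -⟩ := hcentre O hSO hcen
  exact ⟨n, R, P, h0, hstep, hloc, hlt⟩

end Literature.AlgebraicGeometry.Resolution

end
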